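import Summits.CriticalPhenomena.SAWScalingLimit.Theorems.BoundaryClosureNegative_Profile
import Summits.CriticalPhenomena.SAWScalingLimit.Theorems.BoundaryClosureNegative_HalfDisc

/-!
# Negative knowledge on crux `BoundaryClosure` — the corridor refutation of `HexObservableLimit`, part 7: the root and normalisation mid-edges, the straight self-avoiding walk along row `0`, containment in the half-disc, the ball condition, exhaustion.

Support for `SAWDefectDecoherenceHexObservableLimitRefutation.lean` (item stmt-CriticalPhenomena-5420, the conclusion of
crux `BoundaryClosure`, stmt-CriticalPhenomena-8536). Everything proved. [folklore]
-/

noncomputable section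

open Set Filter Topology Complex
open Literature.Probability.RandomPlanarGeometry
open UpperHalfPlane (upperHalfPlaneSet)
open Literature.Probability.LatticeModels Literature.Probability.RandomPlanarGeometry.SAW

namespace Summit.CriticalPhenomena.SAWScalingLimit.Theorems.BoundaryClosure.Negative

/-! ### The roots, the normalisation edge and the straight walk along row `0` -/

/-- The root edge at cell `n`: between the up triangle of cell `n + 1` (outside) and the down
triangle of cell `n` (inside). [folklore] -/
def aEdge (n : ℤ) : Sym2 HexVertex := s(fj (2 * n + 2) 0, fj (2 * n + 1) 0)

/-- The normalisation edge `b`: the vertical edge below the origin face `fj 0 0`, midpoint `1/2`.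
[folklore] -/
def bEdge : Sym2 HexVertex := s(fj 0 0, fj 1 (-1))

/-- The straight walk `[fj m 0, fj (m-1) 0, …, fj 0 0]` along row `0`. [folklore] -/
def rowWalk : ℕ → List HexVertex
  | 0 => [fj 0 0]
  | m + 1 => fj (m + 1) 0 :: rowWalk m

/-- Members of the straight walk. [folklore] -/
theorem mem_rowWalk {m : ℕ} {v : HexVertex} : v ∈ rowWalk m ↔ ∃ i : ℕ, i ≤ m ∧ v = fj i 0 := by
  induction m with
  | zero => simp [rowWalk]
  | succ m ih =>
    simp only [rowWalk, List.mem_cons, ih]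
    constructor
    · rintro (rfl | ⟨i, hi, rfl⟩)
      · exact ⟨m + 1, le_rfl, by push_cast; rfl⟩
      · exact ⟨i, by omega, rfl⟩
    · rintro ⟨i, hi, rfl⟩
      rcases Nat.lt_or_ge i (m + 1) with h | h
      · exact Or.inr ⟨i, by omega, rfl⟩
      · left; have : i = m + 1 := by omega
        subst this; push_cast; rfl

/-- The straight walk is nonempty. [folklore] -/
theorem rowWalk_ne_nil (m : ℕ) : rowWalk m ≠ [] := by cases m <;> simp [rowWalk]

/-- Head of the straight walk. [folklore] -/
theorem head?_rowWalk (m : ℕ) : (rowWalk m).head? = some (fj m 0) := by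
  cases m <;> simp [rowWalk]

/-- The straight walk decomposes as head and a nonempty tail walk. [folklore] -/
theorem rowWalk_succ (m : ℕ) : rowWalk (m + 1) = fj (m + 1) 0 :: rowWalk m := rfl

/-- Last element of the straight walk. [folklore] -/
theorem getLast?_rowWalk (m : ℕ) : (rowWalk m).getLast? = some (fj 0 0) := by
  induction m with
  | zero => rfl
  | succ m ih =>
    obtain ⟨b, l, hbl⟩ := List.exists_cons_of_ne_nil (rowWalk_ne_nil m)
    rw [rowWalk_succ, hbl, List.getLast?_cons_cons, ← hbl, ih]

/-- The straight walk has no repeated vertex. [folklore] -/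
theorem nodup_rowWalk (m : ℕ) : (rowWalk m).Nodup := by
  induction m with
  | zero => simp [rowWalk]
  | succ m ih =>
    rw [rowWalk_succ, List.nodup_cons]
    refine ⟨fun h => ?_, ih⟩
    obtain ⟨i, hi, he⟩ := mem_rowWalk.1 h
    have := (fj_inj.1 he).1; omega

/-- The straight walk is a chain of adjacent faces. [folklore] -/
theorem isChain_rowWalk (m : ℕ) : (rowWalk m).IsChain hexGraph.Adj := by
  induction m with
  | zero => exact List.isChain_singleton _
  | succ m ih =>
    obtain ⟨b, l, hbl⟩ := List.exists_cons_of_ne_nil (rowWalk_ne_nil m)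
    have hb : b = fj m 0 := by
      have := head?_rowWalk m
      rw [hbl] at this
      simpa using this
    rw [rowWalk_succ, hbl]
    rw [hbl] at ih
    refine List.IsChain.cons_cons ?_ ih
    rw [hb]
    exact_mod_cast (adj_fj_succ (m : ℤ) 0).symm

/-- **The straight walk as a self-avoiding walk** from the root edge at cell `N` to the
normalisation edge, in any vertex set containing the faces `fj i 0`, `i ≤ 2N+1`. [folklore] -/
theorem nonempty_rowSAW (Λ : Finset HexVertex) (N : ℕ) (hΛ : ∀ i : ℕ, i ≤ 2 * N + 1 → fj i 0 ∈ Λ) :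
    Nonempty (HexMidEdgeSAW Λ (aEdge N) bEdge) := by
  have hmem : ∀ e ∈ List.zipWith (fun u w => s(u, w)) (rowWalk (2 * N + 1)) (rowWalk (2 * N + 1)).tail,
      ∀ c ∈ e, ∃ i : ℕ, i ≤ 2 * N + 1 ∧ c = fj i 0 := fun e he c hc =>
    mem_rowWalk.1 (forall_mem_of_mem_edges _ e he c hc)
  have haL : aEdge (N : ℤ) ∉ List.zipWith (fun u w => s(u, w)) (rowWalk (2 * N + 1))
      (rowWalk (2 * N + 1)).tail := by
    intro h
    obtain ⟨i, hi, he⟩ := hmem _ h (fj (2 * N + 2) 0) (by unfold aEdge; exact Sym2.mem_mk_left _ _)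
    have := (fj_inj.1 he).1; omega
  have hab : aEdge (N : ℤ) ≠ bEdge := by
    intro h
    have : fj (2 * (N : ℤ) + 2) 0 ∈ bEdge := by rw [← h]; unfold aEdge; exact Sym2.mem_mk_left _ _
    unfold bEdge at this
    rcases Sym2.mem_iff.1 this with h1 | h1
    · have := (fj_inj.1 h1).1; omega
    · have := (fj_inj.1 h1).2; omega
  have hbL : bEdge ∉ List.zipWith (fun u w => s(u, w)) (rowWalk (2 * N + 1))
      (rowWalk (2 * N + 1)).tail := by
    intro he
    obtain ⟨i, hi, he'⟩ := hmem _ he (fj 1 (-1)) (by exact Sym2.mem_mk_right _ _)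
    have := (fj_inj.1 he').2; omega
  have hadj : hexGraph.Adj (fj (2 * (N : ℤ) + 2) 0) (fj (2 * N + 1) 0) := by
    have := (adj_fj_succ (2 * (N : ℤ) + 1) 0).symm
    rwa [show 2 * (N : ℤ) + 1 + 1 = 2 * N + 2 by ring] at this
  refine ⟨{ verts := rowWalk (2 * N + 1)
            subset := fun v hv => ?_
            nodup := nodup_rowWalk _
            isChain := isChain_rowWalk _
            head_mem := fun v hv => ?_
            getLast_mem := fun v hv => ?_
            eq_of_nil := fun h => (rowWalk_ne_nil _ h).elim
            edges_nodup := fun _ => ?_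
            fst_mem := ⟨(SimpleGraph.mem_edgeSet hexGraph).2 hadj, fj (2 * N + 1) 0,
              by unfold aEdge; exact Sym2.mem_mk_right _ _, by exact_mod_cast hΛ (2 * N + 1) le_rfl⟩ }⟩
  · obtain ⟨i, hi, rfl⟩ := mem_rowWalk.1 hv
    exact hΛ i hi
  · rw [head?_rowWalk, Option.some_inj] at hv
    subst hv
    unfold aEdge
    push_cast
    exact Sym2.mem_mk_right _ _
  · rw [getLast?_rowWalk, Option.some_inj] at hv
    subst hv
    exact Sym2.mem_mk_left _ _
  · have hL := edges_nodup (nodup_rowWalk (2 * N + 1))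
    refine List.nodup_append.2 ⟨List.nodup_cons.2 ⟨haL, hL⟩, List.nodup_singleton _, ?_⟩
    intro e he f hf
    rw [List.mem_singleton] at hf
    subst hf
    rcases List.mem_cons.1 he with rfl | he
    · exact hab
    · rintro rfl; exact hbL he

/-! ### Face centres: norms -/

/-- Numerical bounds on `√3`. [folklore] -/
theorem sqrt_three_bounds : Real.sqrt 3 * Real.sqrt 3 = 3 ∧ 17 / 10 < Real.sqrt 3 ∧ Real.sqrt 3 < 7 / 4 := by
  refine ⟨Real.mul_self_sqrt (by norm_num), ?_, ?_⟩
  · rw [Real.lt_sqrt (by norm_num)]; norm_num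
  · rw [Real.sqrt_lt' (by norm_num)]; norm_num

/-- The squared norm of a face centre in coordinates. [folklore] -/
theorem norm_sq_hexCenter_fj (j r : ℤ) :
    ‖hexCenter (fj j r)‖ ^ 2 = (reA j r) ^ 2 + (hexCenter (fj j r)).im ^ 2 := by
  rw [Complex.sq_norm, Complex.normSq_apply, re_hexCenter_fj]; unfold reA; ring

/-! ### Roots, boundary edges, the straight walk in the vertex sets -/

section Geometry

variable {δ : ℝ} (hδ : 0 < δ) (hδ' : δ ≤ 1 / 16) (wc : Bool)
include hδ hδ'

/-- The root cell: the junction cell `X` for the body, the tip cell `T` for body ∪ corridor.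
[folklore] -/
def rootCell (δ : ℝ) (wc : Bool) : ℤ := if wc then Tc δ else Xc δ

/-- `X ≤ rootCell ≤ T`. [folklore] -/
theorem rootCell_bounds : Xc δ ≤ rootCell δ wc ∧ rootCell δ wc ≤ Tc δ := by
  have := Xc_add_two_le_Tc hδ hδ'
  unfold rootCell; split_ifs <;> constructor <;> omega

/-- The row-`0` faces up to the root cell are vertices. [folklore] -/
theorem fj_row_zero_mem {i : ℤ} (h0 : 0 ≤ i) (hi : i ≤ 2 * rootCell δ wc + 1) : fj i 0 ∈ Lam δ wc := by
  rw [fj_mem_Lam_iff hδ hδ']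
  have hXT := Xc_add_two_le_Tc hδ hδ'
  have hX := Xc_pos hδ (δ := δ)
  by_cases hiX : i ≤ 2 * Xc δ + 1
  · refine Or.inl ⟨inStrip_of_small hδ hδ' le_rfl (by norm_num) ?_, fun _ => hiX⟩
    rw [abs_le]; constructor <;> omega
  · have hwc : wc = true := by
      by_contra hne
      have : rootCell δ wc = Xc δ := by unfold rootCell; simp [hne]
      omega
    refine Or.inr ⟨hwc, rfl, by omega, ?_⟩
    have : rootCell δ wc = Tc δ := by unfold rootCell; simp [hwc]
    omega

/-- The outer endpoint of the root edge is not a vertex. [folklore] -/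
theorem fj_root_succ_not_mem : fj (2 * rootCell δ wc + 2) 0 ∉ Lam δ wc := by
  rw [fj_mem_Lam_iff hδ hδ']
  have hb := rootCell_bounds hδ hδ' wc
  rintro (hb' | ⟨hwc, -, -, h2⟩)
  · have := hb'.2 (by norm_num); omega
  · have : rootCell δ wc = Tc δ := by unfold rootCell; simp [hwc]
    omega

/-- The face below the origin face is not a vertex. [folklore] -/
theorem fj_one_neg_one_not_mem : fj 1 (-1) ∉ Lam δ wc := by
  rw [fj_mem_Lam_iff hδ hδ']
  rintro (hb | ⟨-, hc, -⟩)
  · have := hb.1.1.1; omega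
  · omega

/-- **The root edge is a boundary mid-edge.** [folklore] -/
theorem aEdge_mem_boundary : aEdge (rootCell δ wc) ∈ hexDomainBoundary (Lam δ wc) := by
  have hb := rootCell_bounds hδ hδ' wc
  have hX := Xc_pos hδ (δ := δ)
  refine ⟨(SimpleGraph.mem_edgeSet hexGraph).2 ?_, fj (2 * rootCell δ wc + 2) 0,
    fj (2 * rootCell δ wc + 1) 0, rfl, fj_row_zero_mem hδ hδ' wc (by omega) le_rfl,
    fj_root_succ_not_mem hδ hδ' wc⟩
  have := (adj_fj_succ (2 * rootCell δ wc + 1) 0).symm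
  rwa [show 2 * rootCell δ wc + 1 + 1 = 2 * rootCell δ wc + 2 by ring] at this

/-- **The normalisation edge is a boundary mid-edge.** [folklore] -/
theorem bEdge_mem_boundary : bEdge ∈ hexDomainBoundary (Lam δ wc) := by
  have hb := rootCell_bounds hδ hδ' wc
  have hX := Xc_pos hδ (δ := δ)
  refine ⟨(SimpleGraph.mem_edgeSet hexGraph).2 ?_, fj 1 (-1), fj 0 0, Sym2.eq_swap, fj_row_zero_mem hδ hδ' wc
    le_rfl (by omega), fj_one_neg_one_not_mem hδ hδ' wc⟩
  simpa using adj_fj_down (show (0:ℤ) % 2 = 0 by norm_num) 0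

/-- **There is a self-avoiding walk from the root edge to the normalisation edge.** [folklore] -/
theorem nonempty_saw : Nonempty (HexMidEdgeSAW (Lam δ wc) (aEdge (rootCell δ wc)) bEdge) := by
  have hb := rootCell_bounds hδ hδ' wc
  have hX := Xc_pos hδ (δ := δ)
  obtain ⟨N, hN⟩ : ∃ N : ℕ, (N : ℤ) = rootCell δ wc := ⟨(rootCell δ wc).toNat, by omega⟩
  rw [← hN]
  exact nonempty_rowSAW (Lam δ wc) N fun i hi => fj_row_zero_mem hδ hδ' wc (by omega) (by omega)

/-! ### Face centres: inside the half-disc; the ball condition; exhaustion -/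

/-- **Strip faces have centres in the disc of radius `δ⁻¹`, above the real axis.** [folklore] -/
theorem norm_lt_of_inStrip {j r : ℤ} (h : (j, r) ∈ Strip δ) :
    ‖hexCenter (fj j r)‖ < δ⁻¹ ∧ 0 < (hexCenter (fj j r)).im := by
  obtain ⟨hs3, hs1, hs2⟩ := sqrt_three_bounds
  obtain ⟨him1, him2⟩ := im_hexCenter_fj_bounds j r
  have h0 : (0 : ℝ) ≤ r := by exact_mod_cast h.1.1
  have hre : (reA j r) ^ 2 ≤ δ⁻¹ ^ 2 - 3 / 4 * ((r : ℝ) + 1) ^ 2 := (abs_le_W_iff h.1 _).1 h.2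
  have himpos : 0 < (hexCenter (fj j r)).im := by nlinarith
  refine ⟨?_, himpos⟩
  have hsq : ‖hexCenter (fj j r)‖ ^ 2 < δ⁻¹ ^ 2 := by
    rw [norm_sq_hexCenter_fj]
    nlinarith
  exact (pow_lt_pow_iff_left₀ (norm_nonneg _) (by positivity) two_ne_zero).1 hsq

/-- **Corridor faces have centres in the disc of radius `δ⁻¹`, above the real axis.** [folklore] -/
theorem norm_lt_of_inCorr {j r : ℤ} (h : (j, r) ∈ Corr δ) :
    ‖hexCenter (fj j r)‖ < δ⁻¹ ∧ 0 < (hexCenter (fj j r)).im := by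
  obtain ⟨rfl, h1, h2⟩ := h
  obtain ⟨hs3, hs1, hs2⟩ := sqrt_three_bounds
  obtain ⟨him1, him2⟩ := im_hexCenter_fj_bounds j 0
  push_cast at him1 him2
  have himpos : 0 < (hexCenter (fj j 0)).im := by nlinarith
  refine ⟨?_, himpos⟩
  have hT := (Tc_bounds δ).1
  rw [three_div_four_mul] at hT
  have h16 := sixteen_le_inv hδ hδ'
  have hX := Xc_pos hδ (δ := δ)
  have hre1 : 0 ≤ reA j 0 := by
    unfold reA; have : (0:ℝ) ≤ j := by exact_mod_cast (by omega : (0:ℤ) ≤ j)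
    push_cast; linarith
  have hre2 : reA j 0 ≤ 3 * δ⁻¹ / 4 + 1 := by
    unfold reA; have : (j:ℝ) ≤ 2 * Tc δ + 1 := by exact_mod_cast h2
    push_cast; linarith
  have hsq : ‖hexCenter (fj j 0)‖ ^ 2 < δ⁻¹ ^ 2 := by
    rw [norm_sq_hexCenter_fj]
    nlinarith
  exact (pow_lt_pow_iff_left₀ (norm_nonneg _) (by positivity) two_ne_zero).1 hsq


/-- **The rescaled centres of all vertices lie in the half-disc.** [folklore] -/
theorem smul_center_mem_HD {v : HexVertex} (hv : v ∈ Lam δ wc) : (δ : ℂ) * hexCenter v ∈ HD := by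
  rw [← fj_jOf_rOf v] at hv ⊢
  have key : ‖hexCenter (fj (jOf v) (rOf v))‖ < δ⁻¹ ∧ 0 < (hexCenter (fj (jOf v) (rOf v))).im := by
    rcases (fj_mem_Lam_iff hδ hδ').1 hv with hb | ⟨-, hc⟩
    · exact norm_lt_of_inStrip hδ hδ' hb.1
    · exact norm_lt_of_inCorr hδ hδ' hc
  constructor
  · rw [norm_mul, Complex.norm_real, Real.norm_of_nonneg hδ.le]
    calc δ * ‖hexCenter (fj (jOf v) (rOf v))‖ < δ * δ⁻¹ := by gcongr; exact key.1
      _ = 1 := mul_inv_cancel₀ hδ.ne'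
  · rw [Complex.im_ofReal_mul]; exact mul_pos hδ key.2

/-- **The geometric criterion**: a face of a nonnegative row whose centre `c` satisfies
`‖c‖ ≤ A`, with `(im c + √3/3)² + re² - im²`-slack, lies in the strip; quantitatively: if
`‖c‖² + (6/5)‖c‖ + 7/5 ≤ δ⁻²` then `fj j r` is in the strip. [folklore] -/
theorem inStrip_of_norm {j r : ℤ} (h0 : 0 ≤ r)
    (hA : ‖hexCenter (fj j r)‖ ^ 2 + 6 / 5 * ‖hexCenter (fj j r)‖ + 7 / 5 ≤ δ⁻¹ ^ 2) :
    (j, r) ∈ Strip δ := by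
  obtain ⟨hs3, hs1, hs2⟩ := sqrt_three_bounds
  obtain ⟨him1, him2⟩ := im_hexCenter_fj_bounds j r
  set c := hexCenter (fj j r) with hc
  have hn := norm_sq_hexCenter_fj j r
  rw [← hc] at hn
  have hr0 : (0:ℝ) ≤ r := by exact_mod_cast h0
  have himn : c.im ≤ ‖c‖ := by
    have := Complex.abs_im_le_norm c
    exact (le_abs_self _).trans this
  have hnn := norm_nonneg c
  -- (√3/2)(r+1) ≤ im c + √3/3, hence ¾(r+1)² ≤ (im c + √3/3)² ≤ im² + (6/5)‖c‖ + 2/5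
  have key : 3 / 4 * ((r:ℝ) + 1) ^ 2 ≤ c.im ^ 2 + 6 / 5 * ‖c‖ + 2 / 5 := by
    have e1 : Real.sqrt 3 / 2 * ((r:ℝ) + 1) ≤ c.im + Real.sqrt 3 / 3 := by nlinarith
    have e0 : 0 ≤ Real.sqrt 3 / 2 * ((r:ℝ) + 1) := by positivity
    have e2 : (Real.sqrt 3 / 2 * ((r:ℝ) + 1)) ^ 2 ≤ (c.im + Real.sqrt 3 / 3) ^ 2 := by
      nlinarith
    have himnn : 0 ≤ c.im := by nlinarith
    nlinarith
  have hOK : r ∈ OKRow δ := ⟨h0, by nlinarith⟩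
  refine ⟨hOK, (abs_le_W_iff hOK _).2 ?_⟩
  nlinarith

/-- **The ball condition**: inside the ball of radius `1/2` about `0`, the vertices are exactly the
faces of nonnegative rows. [folklore] -/
theorem mem_Lam_iff_of_ball {v : HexVertex} (hv : (δ : ℂ) * hexCenter v ∈ Metric.ball (0 : ℂ) (1 / 2)) :
    v ∈ Lam δ wc ↔ 0 ≤ v.1 1 := by
  rw [← fj_jOf_rOf v] at hv ⊢
  rw [fj_mem_Lam_iff hδ hδ', fj_fst_one]
  set j := jOf v; set r := rOf v
  constructor
  · rintro (hb | ⟨-, hc⟩)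
    · exact hb.1.1.1
    · rw [hc.1]
  · intro h0
    rw [Metric.mem_ball, dist_zero_right, norm_mul, Complex.norm_real, Real.norm_of_nonneg hδ.le] at hv
    have hn : ‖hexCenter (fj j r)‖ < δ⁻¹ / 2 := by
      rw [lt_div_iff₀ (by norm_num : (0:ℝ) < 2)]
      calc ‖hexCenter (fj j r)‖ * 2 = δ⁻¹ * (δ * ‖hexCenter (fj j r)‖) * 2 := by
            rw [← mul_assoc, inv_mul_cancel₀ hδ.ne', one_mul]
        _ < δ⁻¹ * (1 / 2) * 2 := by gcongr
        _ = δ⁻¹ := by ring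
    have h16 := sixteen_le_inv hδ hδ'
    have hnn := norm_nonneg (hexCenter (fj j r))
    refine Or.inl ⟨inStrip_of_norm hδ hδ' h0 (by nlinarith), fun _ => ?_⟩
    -- re c = (j + r + 1)/2 < δ⁻¹/2 ≤ X
    have hre : reA j r ≤ ‖hexCenter (fj j r)‖ := by
      have := Complex.abs_re_le_norm (hexCenter (fj j r))
      rw [re_hexCenter_fj] at this
      exact (le_abs_self _).trans this
    have hX := (Xc_bounds δ).1
    rw [one_div_two_mul] at hX
    unfold reA at hre
    have h0' : (0:ℝ) ≤ r := by exact_mod_cast h0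
    have : (j : ℝ) < 2 * Xc δ := by linarith
    exact_mod_cast (by linarith : (j : ℝ) ≤ 2 * Xc δ + 1)

/-- **Exhaustion**: if all points of `K` have norm `≤ 1 - ε` and height `≥ ε`, then for
`δ ≤ ε/4` every face with rescaled centre in `K` is a vertex. [folklore] -/
theorem mem_Lam_of_thick {ε : ℝ} (hδε : δ ≤ ε / 4) {v : HexVertex}
    (hn : ‖(δ : ℂ) * hexCenter v‖ ≤ 1 - ε) (hi : ε ≤ ((δ : ℂ) * hexCenter v).im) : v ∈ Lam δ wc := by
  rw [← fj_jOf_rOf v, fj_mem_Lam_iff hδ hδ']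
  rw [← fj_jOf_rOf v] at hn hi
  set j := jOf v; set r := rOf v
  rw [norm_mul, Complex.norm_real, Real.norm_of_nonneg hδ.le] at hn
  rw [Complex.im_ofReal_mul] at hi
  set c := hexCenter (fj j r) with hc
  obtain ⟨hs3, hs1, hs2⟩ := sqrt_three_bounds
  obtain ⟨him1, him2⟩ := im_hexCenter_fj_bounds j r
  rw [← hc] at him1 him2
  have h16 := sixteen_le_inv hδ hδ'
  have hnn := norm_nonneg c
  -- `‖c‖ ≤ (1-ε) δ⁻¹` and `ε δ⁻¹ ≤ im c`
  have hn' : ‖c‖ ≤ (1 - ε) * δ⁻¹ := by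
    rw [← div_eq_mul_inv, le_div_iff₀ hδ]; linarith
  have hi' : ε * δ⁻¹ ≤ c.im := by
    rw [← div_eq_mul_inv, div_le_iff₀ hδ]; linarith
  have hA : 4 ≤ ε * δ⁻¹ := by
    rw [← div_eq_mul_inv, le_div_iff₀ hδ]; linarith
  -- the row is nonnegative, indeed at least 2
  have hr2 : (2 : ℤ) ≤ r := by
    by_contra hlt
    push Not at hlt
    have : (r : ℝ) ≤ 1 := by exact_mod_cast (by omega : r ≤ 1)
    have : c.im ≤ 3 / 2 := by nlinarith
    nlinarith
  have hr0 : (0:ℤ) ≤ r := by omega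
  refine Or.inl ⟨inStrip_of_norm hδ hδ' hr0 ?_, fun h1 => by omega⟩
  -- ‖c‖² + (6/5)‖c‖ + 7/5 ≤ δ⁻²  from  ‖c‖ ≤ (1-ε)δ⁻¹, εδ⁻¹ ≥ 4, δ⁻¹ ≥ 16
  have hiv : (0:ℝ) < δ⁻¹ := by positivity
  have e1 : ‖c‖ ^ 2 ≤ (1 - ε) ^ 2 * δ⁻¹ ^ 2 := by
    have : 0 ≤ (1 - ε) * δ⁻¹ := by nlinarith
    nlinarith
  have e2 : ‖c‖ ≤ δ⁻¹ := by nlinarith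
  nlinarith

end Geometry


end Summit.CriticalPhenomena.SAWScalingLimit.Theorems.BoundaryClosure.Negative
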